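import Mathlib
import HarnessLib
import HarnessLib.Audit
import Summits.ValiantsHypothesis.Statement
import Literature.Computability.AlgebraicComplexity.GCT
import Literature.Computability.AlgebraicComplexity.BLMW11KroneckerApproximation
import Literature.Computability.AlgebraicComplexity.BLMW11PermanentApproximationEquivalence
import Literature.Computability.AlgebraicComplexity.ValiantClasses
import Literature.Computability.AlgebraicComplexity.ValiantConjectureProofs
import Literature.Computability.AlgebraicComplexity.StandardFamilies
import HarnessLib.Audit.Status.Attr

/-!
Route: WsBorderSandwich

# Route WsBorderSandwich — VP≠VNP from (per ∉ closure of VP_ws) and (VP ⊆ closure of VP_ws), the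
border sandwich

X = A ∧ B, the BORDER SANDWICH VNP ⊄ closure(VP_ws) ⊇ VP (decomp-valiant cycle 1, lens
«representation-theoretic obstruction
splitting»; LADDER-Valiant rung 0 — nothing here proves VP ≠ VNP). A = PerNotInVPwsBar: the
permanent family is not in the closure
class closure(VP_ws) (superpolynomial approximate weakly-skew complexity, BLMW Def. 9.3.1), typed in
the SAME class language as B and PROVED
equivalent in tree (`borderDcPerSuperpolynomial_iff_not_isVPwsBarFamily_perPoly`, BLMW Prop. 9.3.2
`BLMW2011_prop_9_3_2_holds`) to the registered
orbit-closure conjecture `BorderDcPerSuperpolynomial` (BLMW 2011 Conj. 1.1 = Mulmuley–Sohoni «no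
constant c»: there is no c with X₀₀^(m−n)·per_n ∈
Δ(det_m) = closure of GL_{m²}·det_m for some n ≤ m ≤ n^c + c, every n) and to VNP ⊄ closure(VP_ws).
B = VPSubsetVPwsBar: VP ⊆ closure(VP_ws) — every VP family has
polynomially bounded approximate weakly-skew complexity (BLMW 2011 Def. 9.3.1/§9.3). GCT
multiplicity/occurrence obstructions can at
best deliver A (a separation from closure(VP_ws), «not a priori VP ≠ VNP», BLMW p.21); B is exactly
the «obstruction ⇒ separation of VP
from VNP» half. Every piece is strictly weaker than the summit in the doctrine's sense (neither is
known to imply VP ≠ VNP; neither is barrier-excluded);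
in the critic's tag vocabulary both are UNDECIDED-with-test (neither is a consequence of S either:
the node is S ⟸ A ∧ B, not S ⟺), and
no piece has the residual shape (X → S).
Lean: `(¬ Literature.Computability.AlgebraicComplexity.IsVPwsBarFamily (fun n =>
Literature.Computability.AlgebraicComplexity.perPoly (Fin n) ℂ)) ∧ (∀ {σ : ℕ → Type} [∀ n, Fintype
(σ n)] [∀ n, DecidableEq (σ n)] (f : ∀ n, MvPolynomial (σ n) ℂ),
Literature.Computability.AlgebraicComplexity.IsVPFamily f →
Literature.Computability.AlgebraicComplexity.IsVPwsBarFamily f)`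

## Assembly
Pure logic over the two cruxes plus two PROVED tree theorems: if VP ℂ = VNP ℂ then the permanent
family (in VNP by Valiant 1979,
`perFamily_mem_VNP_holds`, unbundled by `mem_VP_ofFintype_iff_holds`) is a VP family, hence in
closure(VP_ws) by B, contradicting A (both pieces speak the class
language `IsVPwsBarFamily`, so no bridge is needed in `closes`; BLMW Prop. 9.3.2 is used only
beneath A, in its skeleton glue). The deciding theorem
`closes : PerNotInVPwsBar → VPSubsetVPwsBar → Assembly → ValiantsHypothesis` is three lines
(glue.lean, certified); the Assembly item is the
provable-now bookkeeping «VP = VNP ⇒ (per_n) is a VP family» and is consumed by `closes`.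

Rationale: WHY THIS LINE. Mechanism: insert the border class M = closure(VP_ws) (= closure(VBP), polynomial
border determinantal complexity) between VP and VNP;
VP ≠ VNP follows from a LOWER bound for one explicit VNP family against M (piece A — the flagship
target of geometric complexity theory,
MulmuleySohoni2001 Conj. 4.3 / BurgisserEtAl2011 Conj. 1.1, attacked by representation-theoretic
obstructions, proved rung m²/2 by dual
varieties arXiv:1004.4802) and an UPPER bound placing all of VP inside M (piece B — a border
SIMULATION question: VSBR doi:10.1137/0212043
gives closure-free quasi-polynomial simulation, proved in tree
`isQPBounded_determinantalComplexity_of_isVPFamily_holds`; border simulations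
are known to be strictly stronger than exact ones in small models, arXiv:1702.05328 closure(VP_e) =
closure of width-2 ABPs, and
debordering results exist, BLMW Q.9.4.2 / Bürgisser 2004 Thm 5.6 doi:10.1007/s10208-002-0059-5,
Dutta–Dwivedi–Saxena 2021). Imported
areas: invariant theory / representation theory of GL (orbit closures, obstructions) for A;
circuit-structural simulation and ε-power-series
(debordering) algebra for B. What it does that prior routes do not: GCTMult / DetQP carry the
QUASI-POLYNOMIAL border statements, each of which
alone implies VP ≠ VNP (StrongHypotheses.lean) — not admissible as weaker pieces; the census
`Cruxes/ClassTransfer/DecompositionCensus.lean`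
records the affine model split M = VBP (VBP ≠ VNP ∧ per ∈ VP → per ∈ VBP) with «no plan on either
side»; this route is its BORDER version, where the
lower-bound half is literally GCT's existing programme (plan: obstructions; rung LMR13; instrument
(3,6)) and the simulation half gains the
approximation freedom (plan: VP-complete homomorphism polynomials into border-ABPs; debordering
split typed in tree as BLMW Q.9.4.2 + Prop 9.4.3).
Distinct BY CONSTRUCTION from the other lenses' nodes on the bus (2026-08-29): lens-3
DeborderingSquare (S ⟺ P1∧P2∧P3∧P4, every piece a
collapse-conditional «VP = VNP → …» or «debordering → A» on the debordering axis; A only as P1's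
conclusion, B only as evidence `p2_of_borderChasm`;
logically A ⟹ P1 and B ⟹ P2, so this node is the coarser UNCONDITIONAL sandwich above the (P1,P2)
corner, with the representation-theoretic
obstruction-window line under A that no other lens carries); lens-4 (depth-reduction / chasm) and
lens-5 (hardness–randomness / PIT) have no
orbit-closure piece. Pieces here are unconditional class statements with their own attack surfaces
(obstructions, resp. simulation), none of
residual shape.

RANKED CRUXES. #2 VPSubsetVPwsBar (crux) — [piece B · tag UNDECIDED(stated test — neither S ⟹ B nor
B ⟹ S is known; critic rule 1(b): not a consequence of S, hence never WEAKER. TEST: B is REFUTED iff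
some VP family — w.l.o.g. one VP-complete homomorphism-polynomial family, CSR 2016 p.319 — has
superpolynomial approximate weakly-skew complexity; B is PROVED by any border simulation of size-s
degree-d circuits by weakly-skew circuits of size poly(s,d) as ε → 0, i.e. by removing the log d
from VSBR's exponent using approximation) · NECESSARY(a): consumed by `closes`, and A alone is
consistent with VP = VNP (model: VP = VNP ⊄ closure(VP_ws)) · leaves: IDEA-NEEDED (no simulation
beyond VSBR s^O(log d) is known; the border freedom is the unexploited resource — precedents:
closure(VP_e) = closure of width-2 ABPs arXiv:1702.05328, border depth-3 debordering DDS21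
lit:paper:galaxy-pdf-7641649743695546420), ATTACKABLE sub-leaf (reduction to ONE VP-complete family
by closure of closure(VP_ws) under p-projections, tree `IsVPwsBarFamily.of_isPProjection`; skeleton
`VPSubsetVPwsBar_of` kernel-checked, 2 stubs), RUNG proved: the quasi-polynomial weakening (tree
`isQPBounded_determinantalComplexity_of_isVPFamily_holds`, VSBR) · why strictly weaker than the
summit: an inclusion VP ⊆ closure(VP_ws) says nothing about VNP and is not known to imply VP ≠ VNP
(it follows from the open VP = VP_ws and is consistent with VP = VNP) · why novel: no tree route and
no paper found poses VP ⊆ closure(VP_ws) as the complement of the Mulmuley–Sohoni conjecture (BLMW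
p.21 only remarks that conjecture gives «VP_ws ≠ VNP but not a priori VP ≠ VNP»; lens-3's
DeborderingSquare uses it only as sufficient evidence `p2_of_borderChasm` for a collapse-conditional
piece)] VP ⊆ closure(VP_ws): every p-family of p-bounded circuit complexity has p-bounded
approximate weakly-skew complexity (BLMW 2011 Def. 9.3.1, §9.3). [difficulty: open-problem] (why it
might fail: VP may not lie in closure(VP_ws): VP-complete homomorphism polynomials might need
border-ABP size n^Ω(log n) — VSBR's exponent could be tight for ABPs as the depth-3/4 chasm
exponents are (LST 2021), and approximation need not help outside small width/depth.)
[arXiv:0907.2850, doi:10.1137/0212043, arXiv:1702.05328, Burgisser2000,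
doi:10.1007/s10208-002-0059-5, arXiv:1605.02815]
#3 PerNotInVPwsBar (crux) — [piece A · tag UNDECIDED(stated test — A ⟹ S not known:
BurgisserEtAl2011 p.21 «would imply VP_ws ≠ VNP (but not a priori VP ≠ VNP)», StrongHypotheses.lean
bridges only the QUASI-POLYNOMIAL versions to the summit; S ⟹ A not known: Ikenmeyer–Sanyal 2021 p.3
«GCT could fail while Valiant's conjecture holds», so by critic rule 1(b) UNDECIDED not WEAKER; S ⟹
A WOULD follow from polynomial debordering closure(VP_ws) = VP_ws, since then A ⟺ (per ∉ VP_ws) =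
W-ws ⟸ S. TEST: A is DECIDED TRUE by multiplicity obstructions for (det_m, X₀₀^(m−n)per_n)
throughout a window n ≤ m ≤ n^c + c at some n, for every c (kernel glue
`PerNotInVPwsBar_of_obstructions` proved; the GCT key-test instrument searches exactly these at n =
3); DECIDED FALSE by a polynomial border-determinantal expression of the permanent) · A ⟺ (per) ∉
closure(VP_ws) ⟺ VNP ⊄ closure(VP_ws) is PROVED in tree (`BLMW2011_prop_9_3_2_holds`); A is typed in
the i.o. form ¬∃c ∀n … matching S's quantifier shape (critic rule 2) · NECESSARY(a): consumed by
`closes`, and B alone is consistent with VP = VNP (model: everything inside closure(VP_ws)) ·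
leaves: IDEA-NEEDED (multiplicity obstructions in the POLYNOMIAL padding window — the lens's
«existence of obstructions in a named degree range», stub `stub_obstructionWindow`; instrument
census NEGATIVE so far: 0 SIGNAL / 0 CANDIDATE / 0 OBSTRUCTION at (n,m) = (3,4), d ≤ 13, and the
⟨3,6,10⟩/⟨3,6,11⟩ cells INCAPABLE-by-theorem,
run/shared/lean/pub/pub-gct-max/lead/READOUT-SAT-2026-08-29.md and
run/shared/lean/pub/pub-gct-max/HANDOFF.md l.8: K12 «S42» 54/54 + 311/319 + 8/8 keys KILLED),
BARRIER (occurrence obstructions impossible for m ≥ n^25, arXiv:1604.06431 =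
Literature.Barriers.ValiantsHypothesis.GCTOccurrenceObstructions — prices the occurrence sub-method
out of all windows c ≥ 25, so A via obstructions needs genuine MULTIPLICITY comparisons; rectangular
Kronecker positivity arXiv:1512.03798 = IP17RectangularKronecker; short-first-row modules useless,
GCTUsefulModules), INSTRUMENTABLE (base instance (n,m) = (3,6): border dc of per₃ ∈ {5,6,7},
LADDER-Valiant row 11, run/shared/lean/pub/ladder-directors/LADDER-Valiant.md; a computation can
move A's obstruction child one cell at a time), ATTACKABLE (proved rung: the sub-quadratic windows
are excluded, border-dc(per_m) ≥ m²/2, tree `LMR2013_thm_1_1_1_holds`, arXiv:1004.4802, rung file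
`PerNotInVPwsBar_rung`; next rung: any superquadratic border bound; DEBORDERING line A ⟸ (per ∉
VP_ws = tree `DcPerSuperpolynomial ℂ`, a consequence of the summit = TREE.md W-ws) ∧ (BLMW Q.9.4.2,
tree `BLMW2011_question_9_4_2`), glued by the DISCHARGED `BLMW2011_prop_9_4_3_holds`, composition
`PerNotInVPwsBar_of` kernel-checked) · why strictly weaker than the summit: A separates VNP only
from the border class closure(VP_ws) and is not known to imply VP ≠ VNP (BLMW p.21) · why novel as a
piece: in the tree A is only GCTMult's milestone support GctPolyMs (value-equal to the stronger
«eventually» form MulmuleySohoniConjecture), never load-bearing; lens-3 has it only as the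
conclusion of its piece P1 = (debordering → A)] The permanent family (per_n)_n is not in
closure(VP_ws): its approximate weakly-skew complexity is not polynomially bounded (BLMW 2011 Def.
9.3.1) — equivalently (proved, Prop. 9.3.2) there is no constant c such that for every n the padded
permanent X₀₀^(m−n)·per_n lies in Δ(det_m) for some n ≤ m ≤ n^c + c (BLMW 2011 Conj. 1.1;
Mulmuley–Sohoni 2001 Conj. 4.3). Registered STRONGER hypotheses MulmuleySohoniConjectureQP /
BorderDcPerSuperQuasipolynomial / GCTMultiplicityObstructionsQP (StrongHypotheses.lean) each imply A
through the landed `borderDcPerSuperpolynomial_of_mulmuleySohoni_holds` + Prop. 9.3.2: A is their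
POLYNOMIAL-window weakening and the route uses exactly that weakening — B is load-bearing because A
is not quasi-polynomial, and no quasi-polynomial statement is ever invoked (rule (a) disclosure).
[difficulty: open-problem] (why it might fail: per might have polynomial BORDER determinantal
expressions although dc(per) is superpolynomial — approximation strictly helps in small models
(arXiv:1702.05328; border Waring rank) and only border-dc(per_m) ≥ m²/2 is proved (arXiv:1004.4802);
every (3,m≤6) obstruction search so far is empty.) [MulmuleySohoni2001, arXiv:0907.2850,
arXiv:1004.4802, arXiv:1604.06431, arXiv:1512.03798, arXiv:2102.07173, Landsberg2017]

TWO-LAYER PLAN. Foreseen glued splits (skeletons already kernel-checked in the planner folder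
bc/Births.lean, sorries only in the 5 stubs; nothing filed now):
A ⇐ D → Q → A with D = `DcPerSuperpolynomial ℂ` ((per) ∉ VP_ws — a CONSEQUENCE of the summit,
classical target: Mignon–Ressayre n²/2,
Grenet 2^n − 1), Q = `BLMW2011_question_9_4_2` (polynomial order of approximation along det-orbits;
exponential bound Bürgisser 2004 Thm 5.6),
P = `BLMW2011_prop_9_4_3_holds` (Q ⇒ closure(VP_ws) = VP_ws, DISCHARGED in tree — glue, not an
item); A ⇐ ObstructionWindow → A (the GCT line,
stub `stub_obstructionWindow`: for every c some n with a multiplicity obstruction for (det_m,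
X₀₀^(m−n)per_n) at every n ≤ m ≤ n^c + c;
glue `PerNotInVPwsBar_of_obstructions` PROVED from the obstruction principle
`not_hasMultiplicityObstruction_of_mem_orbitClosure`);
B ⇐ U → C → B with U = «VP has a p-complete family» (known: Bürgisser 2000 §5, CSR 2016 p.319
homomorphism polynomials) and C = «every
VP-complete family lies in closure(VP_ws)», glue = `IsVPwsBarFamily.of_isPProjection` (proved).

KILL CRITERIA. Refutation of VPSubsetVPwsBar (an explicit VP family outside closure(VP_ws) — itself
a landmark superpolynomial border-ABP lower bound) closes
the route `refuted:VPSubsetVPwsBar`; the affine model split M = VBP of the census is then the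
fallback and inherits nothing. Refutation of
PerNotInVPwsBar (polynomial border-determinantal expressions for per) closes the route AND retires
GCTMult's milestone; pivot: none on this
axis. A proof of VP = VP_ws elsewhere makes B a theorem and the route collapses to A ⟺ VBP ≠ VNP ⟺
VP ≠ VNP (then A is summit-strength and the
route is superseded by DetQP's poly support line).

NOT DECOMPOSED YET. Exponent windows of A (fixed c: dc-bar(per_n) > n^c eventually — genuine weaker
rungs, filed only when a method reaches c = 2⁺); the
Kronecker rendering of the obstruction child (tree `orbitMultiplicity_det_le_kroneckerCoeff_holds`);
order-of-approximation regimes of Q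
(polynomial / quasi-polynomial); the choice of the VP-complete family for B's child C. All are
layer-2 children for tenure.

CHEAPEST FALSIFIER. Lookup (ran 2026-08-29): is any explicit VP family known to require
superpolynomial BORDER weakly-skew / determinantal size? No — the best
explicit border-dc lower bound in print is m²/2 for the permanent (arXiv:1004.4802, a VNP family);
the best affine ABP lower bounds for VP
families are quadratic (Chatterjee–Kumar–She–Volk). So B survives the cheapest check; for A the
cheapest check is the (3,6) instrument row
(border dc of per₃ ∈ {5,6,7}; no obstruction found at degrees ≤ 11) which cannot refute an
asymptotic statement — A's cheapest REAL falsifier is a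
polynomial border expression for per, none known (Grenet 2^n − 1 affine is the record).

NUMBERS. border-dc(per_m) ≥ m²/2 (arXiv:1004.4802; tree `LMR2013_thm_1_1_1_holds`); dc(per_m) ≥ m²/2
(Mignon–Ressayre 2004, doi:10.1155/S1073792804142566);
dc(per_m) ≤ 2^m − 1 (Grenet 2011); border dc of per₃ ∈ {5,6,7}, dc(per₃) = 7 (LADDER-Valiant row
11); VSBR: size-s degree-d circuits → weakly-skew
size s^O(log d) (doi:10.1137/0212043; tree
`isQPBounded_determinantalComplexity_of_isVPFamily_holds`); order of approximation q ≤ 2^(L̄(f)²)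
(Bürgisser 2004 Thm 5.6, held arXiv:1812.06828 p.14); no occurrence obstructions for m ≥ n^25
(arXiv:1604.06431); instrument: 0/168+ obstruction
candidates at (3,4),(3,6) (READOUT-SAT-2026-08-29.md).

DEFINITION REQUESTS. None: every notion is in the tree (`BorderDcPerSuperpolynomial`, `IsVPFamily`,
`IsVPwsBarFamily`, `approxWsComplexity`, `BLMW2011_question_9_4_2`).

Novelty: Searches (2026-08-29): lit search --hybrid «closure of VP_ws approximation order polynomially
bounded Question 9.4.2» (5 docs, BCS97/noise); lit search --hybrid «is VP equal to VP_ws weakly skew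
… branching programs» (Landsberg2017 pp.183–190, BCS97); lit search --hybrid «homomorphism
polynomials complete for VP» (CSR 2016 p.319 hit); lit search «geometric complexity theory overview
… weakly skew» --source local (paper:arxiv-0907.2850 p.21); lit search «Boundaries of VP and VNP»
(paper:arxiv-1605.02815); lit search «Bürgisser complexity of factors … order»
(paper:arxiv-1812.06828, doi:10.1007/s10208-002-0059-5); lit galaxy search «weakly
skew|weakly-skew|VP_{ws}» --star all (16 rows; 1 relevant: galaxy:pdf:-8229590352537640020 HAL
ensl-00504925); lit galaxy search «debordering|de-bordering|order of approximation» --star all (24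
rows, 0 relevant); lit galaxy search «VBP = VP|VP = VBP|…» --star all (1 row, 0 relevant); lit
galaxy search --star pdf --mode bm25 «debordering border complexity algebraic branching programs
approximative closure VP» (6 hits: galaxy:pdf:7641649743695546420 DDS21,
galaxy:pdf:-1561796166617785780 GMQ16, CCC 2024 set-multilinear ABPs); rg over the 77 Valiant Theses
files for BorderDcPerSuperpolynomial / IsVPwsBarFamily / approxWsComplexity (only GCTMult, as
milestone support); ledger negatives --problem ValiantsHypothesis (32 entries, none on border
classes).
Nearest prior art found: arXiv:0907.2850 (BLMW 2011) Prop. 9.3.2 + p.21 remark — proves A ⟺ VNP  [refs: 10.1007/s10208-002-0059-5, 0907.2850, 1605.02815, paper:arxiv-0907.2850, paper:arxiv-1605.02815, paper:arxiv-1812.06828, doi:10.1007/s10208-002-0059-5, Landsberg2017]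

Barriers (technique_class: gct-orbit-closure, border-complexity, circuit-simulation): - technique_class: gct-orbit-closure, border-complexity, circuit-simulation
- Literature.Barriers.ValiantsHypothesis.GCTOccurrenceObstructions: bites only the OCCURRENCE
sub-method for A at m ≥ n^25 (arXiv:1604.06431; together with the rectangular-Kronecker no-go
arXiv:1512.03798, file Literature/Barriers/ValiantsHypothesis/IP17RectangularKronecker.lean); A is
the statement not the method, and its obstruction child `stub_obstructionWindow` asks for
MULTIPLICITY obstructions (not excluded) — occurrence is usable only in the windows c < 25, and a
multiplicity flip needs a per-side lower bound exceeding a POSITIVE Kronecker coefficient (tree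
`orbitMultiplicity_det_le_kroneckerCoeff_holds` is the det-side upper bound); it does not make
finding them easier — the instrument census is so far empty; B is outside the class (no
obstructions).
- Literature.Barriers.ValiantsHypothesis.GCTUsefulModules: constrains the partitions of any
obstruction for A (long first row, ≤ m²+1 parts); honoured by construction in the obstruction child
(search restricted to Kadish–Landsberg-useful modules); B untouched.
- Literature.Barriers.ValiantsHypothesis.NotViaSaturations: asymptotic/saturation occurrence
obstructions cannot separate; the obstruction child is stated with honest multiplicities at finite
degree d, outside the saturation class; it does not make finding them easier.
- Literature.Barriers.ValiantsHypothesis.AlgebraicNaturalProofs: CONDITIONAL (succinct hitting sets)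
barrier against poly-de

sub-problem: ValiantsHypothesis · status: draft · opened planner-decomp-val-lens-1-g0-0 2026-08-29T18:01:06Z · rev 0 · ledger route-ValiantsHypothesis-WsBorderSandwich
GENERATED by the gate from the ledger (D-0016/17). Provers cite these decls: `theorem foo : Summit.ValiantsHypothesis.ValiantsHypothesis.Theses.WsBorderSandwich.<Decl> := …` in Summits/ValiantsHypothesis/ValiantsHypothesis/Theorems/<Name>.lean.
-/

namespace Summit.ValiantsHypothesis.ValiantsHypothesis.Theses.WsBorderSandwich

open scoped BigOperators Topology Manifold Classical MeasureTheory ProbabilityTheory Matrix InnerProductSpace ComplexConjugate ContinuousMap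
open Filter Set Function TopologicalSpace MeasureTheory

attribute [summit_statement] _root_.ValiantsHypothesis

open Literature.PNP

/-- item stmt-ValiantsHypothesis-23468 · crux · rank 2 · open · by planner
why it might fail: VP may not lie in closure(VP_ws): VP-complete homomorphism polynomials might need border-ABP size n^Ω(log n) — VSBR's exponent could be tight for ABPs as the depth-3/4 chasm exponents are (LST 2021), and approximation need not help outside small width/depth.
sources: arXiv:0907.2850, doi:10.1137/0212043, arXiv:1702.05328, Burgisser2000, doi:10.1007/s10208-002-0059-5, arXiv:1605.02815
[crux] [piece B · tag UNDECIDED(stated test — neither S ⟹ B nor B ⟹ S is known; critic rule 1(b):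
not a consequence of S, hence never WEAKER. TEST: B is REFUTED iff some VP family — w.l.o.g. one
VP-complete homomorphism-polynomial family, CSR 2016 p.319 — has superpolynomial approximate
weakly-skew complexity; B is PROVED by any border simulation of size-s degree-d circuits by
weakly-skew circuits of size poly(s,d) as ε → 0, i.e. by removing the log d from VSBR's exponent
using approximation) · NECESSARY(a): consumed by `closes`, and A alone is consistent with VP = VNP
(model: VP = VNP ⊄ closure(VP_ws)) · leaves: IDEA-NEEDED (no simulation beyond VSBR s^O(log d) is
known; the border freedom is the unexploited resource — precedents: closure(VP_e) = closure of
width-2 ABPs arXiv:1702.05328, border depth-3 debordering DDS21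
lit:paper:galaxy-pdf-7641649743695546420), ATTACKABLE sub-leaf (reduction to ONE VP-complete family
by closure of closure(VP_ws) under p-projections, tree `IsVPwsBarFamily.of_isPProjection`; skeleton
`VPSubsetVPwsBar_of` kernel-checked, 2 stubs), RUNG proved: the quasi-polynomial weakening (tree
`isQPBounded_determinantalComplexity_of_isVPFamily_holds`, VSBR) · why -/
@[route_item "route-ValiantsHypothesis-WsBorderSandwich", crux]
def VPSubsetVPwsBar : Prop :=
  ∀ {σ : ℕ → Type} [∀ n, Fintype (σ n)] [∀ n, DecidableEq (σ n)] (f : ∀ n, MvPolynomial (σ n) ℂ), Literature.Computability.AlgebraicComplexity.IsVPFamily f → Literature.Computability.AlgebraicComplexity.IsVPwsBarFamily f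

/-- item stmt-ValiantsHypothesis-23469 · crux · rank 3 · open · by planner
why it might fail: per might have polynomial BORDER determinantal expressions although dc(per) is superpolynomial — approximation strictly helps in small models (arXiv:1702.05328; border Waring rank) and only border-dc(per_m) ≥ m²/2 is proved (arXiv:1004.4802); every (3,m≤6) obstruction search so far is empty.
sources: MulmuleySohoni2001, arXiv:0907.2850, arXiv:1004.4802, arXiv:1604.06431, arXiv:1512.03798, arXiv:2102.07173
[crux] [piece A · tag UNDECIDED(stated test — A ⟹ S not known: BurgisserEtAl2011 p.21 «would imply
VP_ws ≠ VNP (but not a priori VP ≠ VNP)», StrongHypotheses.lean bridges only the QUASI-POLYNOMIAL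
versions to the summit; S ⟹ A not known: Ikenmeyer–Sanyal 2021 p.3 «GCT could fail while Valiant's
conjecture holds», so by critic rule 1(b) UNDECIDED not WEAKER; S ⟹ A WOULD follow from polynomial
debordering closure(VP_ws) = VP_ws, since then A ⟺ (per ∉ VP_ws) = W-ws ⟸ S. TEST: A is DECIDED TRUE
by multiplicity obstructions for (det_m, X₀₀^(m−n)per_n) throughout a window n ≤ m ≤ n^c + c at some
n, for every c (kernel glue `PerNotInVPwsBar_of_obstructions` proved; the GCT key-test instrument
searches exactly these at n = 3); DECIDED FALSE by a polynomial border-determinantal expression of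
the permanent) · A ⟺ (per) ∉ closure(VP_ws) ⟺ VNP ⊄ closure(VP_ws) is PROVED in tree
(`BLMW2011_prop_9_3_2_holds`); A is typed in the i.o. form ¬∃c ∀n … matching S's quantifier shape
(critic rule 2) · NECESSARY(a): consumed by `closes`, and B alone is consistent with VP = VNP
(model: everything inside closure(VP_ws)) · leaves: IDEA-NEEDED (multiplicity obstructions in the
POLYNOMIAL padding window — the -/
@[route_item "route-ValiantsHypothesis-WsBorderSandwich", crux]
def PerNotInVPwsBar : Prop :=
  ¬ Literature.Computability.AlgebraicComplexity.IsVPwsBarFamily (fun n => Literature.Computability.AlgebraicComplexity.perPoly (Fin n) ℂ)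

/-- item stmt-ValiantsHypothesis-23470 · assembly · rank 1 · closed · proved by Summit.ValiantsHypothesis.ValiantsHypothesis.Theorems.WsBorderSandwichAssembly.assembly_holds (planner) · by planner
sources: Valiant1979, Burgisser2000
[assembly] [glue item · tag WEAKER(evidence: PROVED outright — `example : Assembly` in the planner's
Sketch.lean, from tree `perFamily_mem_VNP_holds` (Valiant 1979) and `mem_VP_ofFintype_iff_holds`;
hence trivially a consequence of S and not the summit; leaf ATTACKABLE = provable-now, first prover
target) · consumed by `closes`] if VP ℂ = VNP ℂ then the permanent family (perPoly (Fin n) ℂ)_n is a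
VP family — `perFamily_mem_VNP_holds` unbundled along `mem_VP_ofFintype_iff_holds`. -/
@[route_item "route-ValiantsHypothesis-WsBorderSandwich", crux]
def Assembly : Prop :=
  Literature.Computability.AlgebraicComplexity.VP ℂ = Literature.Computability.AlgebraicComplexity.VNP ℂ → Literature.Computability.AlgebraicComplexity.IsVPFamily (fun n => Literature.Computability.AlgebraicComplexity.perPoly (Fin n) ℂ)

-- `Assembly` holds: proved by `Summit.ValiantsHypothesis.ValiantsHypothesis.Theorems.WsBorderSandwichAssembly.assembly_holds` (its module imports this route file, so no `_holds` link can be stated here).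

/-! D-0027 §2.1 — DECIDING THEOREM (planner-authored via `route open/edit --closes-file`; by planner-decomp-val-lens-1-g0-0 2026-08-29T18:01:06Z):
its hypotheses are this route's items and its conclusion the sub-problem Statement (glue_lint), and it elaborates with this file. -/

@[closes "route-ValiantsHypothesis-WsBorderSandwich"] theorem closes (hA : PerNotInVPwsBar) (hB : VPSubsetVPwsBar) (hAsm : Assembly) :
    _root_.ValiantsHypothesis := by
  show Literature.Computability.AlgebraicComplexity.VP ℂ ≠ Literature.Computability.AlgebraicComplexity.VNP ℂ
  intro hEq
  exact hA (hB _ (hAsm hEq))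

end Summit.ValiantsHypothesis.ValiantsHypothesis.Theses.WsBorderSandwich
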